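import Literature.AlgebraicGeometry.Motives.AbelianVarietyBaseChangeFaithful
import Literature.AlgebraicGeometry.Motives.AbelianVarietyBaseChangeTower
import Mathlib.NumberTheory.NumberField.Basic
import HarnessLib

/-!
# Descent of a ring of endomorphisms along a descent of the abelian variety

Topic `AlgebraicGeometry/Motives`; namespace `Literature.AlgebraicGeometry.Motives` (grouping sub-namespace
`AbelianVariety`, the tree's structure).  One small definition with a body (`AbelianVariety.endTransport`, the ring
homomorphism `End A₁ → End A` attached to an isomorphism `A₁ ⊗_k Ω ≅ A`) and theorems; no named fact, no instance.
Cell hodgecm-mathlib, fan B, rung B-II, row II-2 (skeleton `b2-prop26-number-field`, stub (γ′)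
`stub_descentToNumberField`): the CM-STRUCTURE HALF of the descent `ℚ̄ →` number field of [Shimura1998] §12.4
Prop. 26 — «descent of `ι : 𝓞_K → End A` through the same descent» — separated from the descent of the VARIETY with
finitely many endomorphisms (the tree's `AbelianVariety.exists_finset_intermediateField_descent` and its sequel carrying
a finite family of endomorphisms, another seat).  CM-free and independent of that sequel.  HC_CM is proved only modulo
the 7 printed citations until rung 0 closes; nothing here changes that.

## Mathematics

Let `k ⊆ Ω` be fields, `A₁` an abelian variety over `k`, `A` one over `Ω` and `e : A₁ ⊗_k Ω ≅ A`.

* §1 `AbelianVariety.endTransport e : End A₁ →+* End A`, `f ↦ e⁻¹ ∘ f_Ω ∘ e` — a RING homomorphism (base change of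
  homomorphisms is functorial and additive: the tree's `Hom.baseChange_id/_comp/_add`), INJECTIVE
  (`endTransport_injective`: base change of homomorphisms along a field extension is injective, the tree's
  `Hom.baseChange_injective` = [GortzWedhorn2020] Thm. 14.72 (1), and `e` is an isomorphism), and
  `endTransport e f₁ = f ↔ f₁_Ω ≫ e.hom = e.hom ≫ f` (`endTransport_apply_eq_iff`) — the «equivariant comparison» clause
  of the skeleton's statements.
* §2 Pure algebra (PRIVATE helpers): an injective ring homomorphism `φ : S → T` and a ring homomorphism `ι : R → T` whose values on a
  set of RING GENERATORS of `R` lie in the image of `φ` factor UNIQUELY, `ι = φ ∘ ι₁`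
  (`exists_ringHom_comp_eq_of_forall_mem_range`, `ringHom_comp_left_cancel`, `forall_mem_range_of_subring_closure_eq_top`);
  and a set spanning `R` as a `ℤ`-module generates it as a ring (`subring_closure_eq_top_of_span_int_eq_top`), so a
  `ℤ`-basis of `𝓞_K` (Mathlib `NumberField.RingOfIntegers.basis`) is a finite set of ring generators.
* §3 **`AbelianVariety.existsUnique_ringHom_end_descent`**: if `ι : R →+* End A` and every generator `g ∈ G`
  (`Subring.closure G = ⊤`) has `ι g = e⁻¹ ∘ (f₁)_Ω ∘ e` for SOME `f₁ ∈ End A₁`, then there is a UNIQUE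
  `ι₁ : R →+* End A₁` with `(ι₁ a)_Ω ≫ e.hom = e.hom ≫ ι a` for all `a` — [Shimura1998] §12.4, proof of Prop. 26
  (p0125 L12–p0126 L1): once `A` and the finitely many endomorphisms `ι(generators)` are defined over the smaller
  field, «`ι` is defined over it» because `End` is torsion-free and base change of endomorphisms is injective; with the
  `𝓞_K`-forms `existsUnique_ringHom_ringOfIntegers_end_descent` (generators = a `ℤ`-basis `b` of `𝓞_K`, hypothesis
  on the finitely many `ι (b i)`) and `exists_ringHom_ringOfIntegers_end_descent_of_family` (hypothesis = a family
  `r₁ : ι' → End A₁` with `(r₁ i)_Ω ≫ e.hom = e.hom ≫ ι (b i)`, the output shape of a descent of `A` carrying the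
  finite family `i ↦ ι (b i)`).

* §4 `AbelianVariety.towerComparison e₀ e₁ : A₀ ⊗_k S ≅ A` from `e₀ : A₀ ⊗_k k′ ≅ A₁` and `e₁ : A₁ ⊗_{k′} S ≅ A` in a
  tower `k → k′ → S` (the tree's `baseChangeTowerIso`, [GortzWedhorn2020] Prop. 4.16), and
  `Hom.baseChange_comp_towerComparison_hom`: equivariant comparisons COMPOSE — if `ι₀ ↦ ι₁` along `e₀` and `ι₁ ↦ ι`
  along `e₁` then `ι₀ ↦ ι` along `towerComparison e₀ e₁` (`exists_iso_forall_baseChange_comp_eq_of_tower`).  With §3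
  this is all the `𝓞_K`-bookkeeping of the two-step descent `ℂ ← ℚ̄ ← k₁`.

NOT here: the descent of the variety / of a finite family of endomorphisms to a finitely generated or number field
(EGA IV₃ §8; the tree's `Motives/AbelianVarietyFGSubfieldDescent` and its sequel), polarisations, CM types.

## References
* [Shimura1998] G. Shimura, *Abelian Varieties with Complex Multiplication and Modular Functions* (1998), §12.4
  Prop. 26 and its proof (corpus p0125 L9, L12–p0126 L1).
* [GortzWedhorn2020] U. Görtz, T. Wedhorn, *Algebraic Geometry I* (2nd ed. 2020), Thm. 14.72 (1) (faithfully flat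
  descent of morphisms), Remark 16.54 (base change of group schemes).
* [MumfordAV1970] D. Mumford, *Abelian Varieties* (1970), §19 (p. 176: `End_k(A) ⊆ End_{k'}(A_{k'})`, torsion-free).
-/

set_option autoImplicit false

noncomputable section

universe u v w

open CategoryTheory Function NumberField

namespace Literature.AlgebraicGeometry.Motives

/-! ### §2 (algebra first). Factoring a ring homomorphism through an injective one -/

section Algebra

variable {R : Type u} {S : Type v} {T : Type w} [Ring R] [Ring S] [Ring T]

/-- **Factorisation through an injective ring homomorphism**: if `φ : S → T` is injective and every value of
`ι : R → T` lies in the image of `φ`, then `ι = φ ∘ ι₁` for a ring homomorphism `ι₁ : R → S` (namely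
`ι₁ = φ⁻¹ ∘ ι` on the image, Mathlib `RingHom.rangeRestrict` / `RingEquiv.ofBijective` / `RingHom.codRestrict`). [folklore] -/
private theorem exists_ringHom_comp_eq_of_forall_mem_range (φ : S →+* T) (hφ : Injective φ) (ι : R →+* T)
    (h : ∀ r, ι r ∈ φ.range) : ∃ ι₁ : R →+* S, φ.comp ι₁ = ι := by
  have hinj : Injective φ.rangeRestrict := fun a b hab => hφ (by
    have := congrArg (Subtype.val : φ.range → T) hab
    rwa [RingHom.coe_rangeRestrict, RingHom.coe_rangeRestrict] at this)
  let ψ : S ≃+* φ.range := RingEquiv.ofBijective φ.rangeRestrict ⟨hinj, φ.rangeRestrict_surjective⟩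
  refine ⟨(ψ.symm : φ.range →+* S).comp (ι.codRestrict φ.range h), RingHom.ext fun r => ?_⟩
  have hψ : φ.rangeRestrict (ψ.symm ⟨ι r, h r⟩) = ⟨ι r, h r⟩ := ψ.apply_symm_apply _
  have hval := congrArg (Subtype.val : φ.range → T) hψ
  rw [RingHom.coe_rangeRestrict] at hval
  exact hval

/-- The factorisation through an injective ring homomorphism is unique. [folklore] -/
private theorem ringHom_comp_left_cancel (φ : S →+* T) (hφ : Injective φ) {ι₁ ι₂ : R →+* S}
    (h : φ.comp ι₁ = φ.comp ι₂) : ι₁ = ι₂ :=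
  RingHom.ext fun r => hφ (by rw [← RingHom.comp_apply, h, RingHom.comp_apply])

/-- If the values of `ι` on a set `G` of RING GENERATORS of `R` (`Subring.closure G = ⊤`) lie in the subring
`φ.range`, then all values of `ι` do (`{r | ι r ∈ range φ}` is a subring containing `G`). [folklore] -/
private theorem forall_mem_range_of_subring_closure_eq_top (φ : S →+* T) (ι : R →+* T) {G : Set R}
    (hG : Subring.closure G = ⊤) (h : ∀ g ∈ G, ι g ∈ φ.range) (r : R) : ι r ∈ φ.range := by
  have hle : Subring.closure G ≤ φ.range.comap ι := Subring.closure_le.mpr fun g hg => h g hg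
  rw [hG, top_le_iff] at hle
  have hr : r ∈ φ.range.comap ι := by rw [hle]; exact Subring.mem_top r
  exact hr

/-- A subset spanning `R` as a `ℤ`-module generates `R` as a ring (the subring it generates contains the additive
subgroup it generates, Mathlib `Submodule.span_int_eq_addSubgroupClosure`). [folklore] -/
private theorem subring_closure_eq_top_of_span_int_eq_top {G : Set R} (hG : Submodule.span ℤ G = ⊤) :
    Subring.closure G = ⊤ := by
  rw [eq_top_iff]
  intro r _
  have hr : r ∈ (Submodule.span ℤ G).toAddSubgroup := by rw [hG]; trivial
  rw [Submodule.span_int_eq_addSubgroupClosure] at hr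
  exact (AddSubgroup.closure_le (K := (Subring.closure G).toAddSubgroup)).mpr Subring.subset_closure hr

/-- The range of a `ℤ`-basis of `R` generates `R` as a ring; e.g. Mathlib's `NumberField.RingOfIntegers.basis K`,
a finite set of ring generators of `𝓞 K`. [folklore] -/
private theorem subring_closure_range_basis_eq_top {ι' : Type*} (b : Module.Basis ι' ℤ R) :
    Subring.closure (Set.range b) = ⊤ :=
  subring_closure_eq_top_of_span_int_eq_top b.span_eq

end Algebra

/-! ### §1. `End A₁ → End A` along `e : A₁ ⊗_k Ω ≅ A` -/

namespace AbelianVariety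

variable {k : Type u} [Field k] {Ω : Type u} [Field Ω] [Algebra k Ω]
variable {A₁ : AbelianVariety k} {A : AbelianVariety Ω}

/-- **Transport of endomorphisms along `e : A₁ ⊗_k Ω ≅ A`**: the ring homomorphism `End A₁ → End A`,
`f ↦ e⁻¹ ≫ f_Ω ≫ e` (diagrammatic order; `f_Ω = Hom.baseChange Ω f`).  Multiplicative because base change of
homomorphisms is functorial (`Hom.baseChange_id`, `Hom.baseChange_comp`), additive because it is additive
(`Hom.baseChange_add`; the category of abelian varieties is preadditive).  [Mumford AV §19 p. 176: `End_k(A) ⊆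
End_{k'}(A_{k'})`, here followed by the identification `A₁ ⊗ Ω ≅ A`.] [cite: MumfordAV1970, §19 (p. 176)]
[cite: GortzWedhorn2020, Remark 16.54] -/
def endTransport (e : A₁.baseChange Ω ≅ A) : End A₁ →+* End A where
  toFun f := e.inv ≫ Hom.baseChange Ω f ≫ e.hom
  map_one' := by
    change e.inv ≫ Hom.baseChange Ω (𝟙 A₁) ≫ e.hom = 𝟙 A
    rw [Hom.baseChange_id, Category.id_comp, Iso.inv_hom_id]
  map_mul' f g := by
    change e.inv ≫ Hom.baseChange Ω (g ≫ f) ≫ e.hom = (e.inv ≫ Hom.baseChange Ω g ≫ e.hom) ≫ (e.inv ≫ Hom.baseChange Ω f ≫ e.hom)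
    rw [Hom.baseChange_comp]
    simp only [Category.assoc, Iso.hom_inv_id_assoc]
  map_zero' := by
    change e.inv ≫ Hom.baseChange Ω (0 : A₁ ⟶ A₁) ≫ e.hom = 0
    rw [Hom.baseChange_zero, Limits.zero_comp, Limits.comp_zero]
  map_add' f g := by
    have h1 : Hom.baseChange Ω (f + g) = Hom.baseChange Ω f + Hom.baseChange Ω g := Hom.baseChange_add Ω f g
    change e.inv ≫ Hom.baseChange Ω (f + g) ≫ e.hom = _
    rw [h1, Preadditive.add_comp, Preadditive.comp_add]
    rfl

/-- `endTransport e f = e⁻¹ ≫ f_Ω ≫ e` (definitional). [cite: MumfordAV1970, §19 (p. 176)] -/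
@[simp] theorem endTransport_apply (e : A₁.baseChange Ω ≅ A) (f : End A₁) :
    endTransport e f = e.inv ≫ Hom.baseChange Ω f ≫ e.hom := rfl

/-- **`endTransport e f₁ = f` iff `(f₁)_Ω ≫ e.hom = e.hom ≫ f`** — the equivariance clause «`Hom.baseChange Ω (ι₁ a) ≫
e.hom = e.hom ≫ ι a`» of the descent statements is `endTransport e ∘ ι₁ = ι`. [cite: Shimura1998, §12.4 Prop. 26 (p0125 L9)] -/
theorem endTransport_apply_eq_iff (e : A₁.baseChange Ω ≅ A) (f₁ : End A₁) (f : End A) :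
    endTransport e f₁ = f ↔ Hom.baseChange Ω f₁ ≫ e.hom = e.hom ≫ f := by
  change e.inv ≫ Hom.baseChange Ω (f₁ : A₁ ⟶ A₁) ≫ e.hom = (f : A ⟶ A) ↔ _
  exact Iso.inv_comp_eq e

/-- **`endTransport e` is injective**: base change of homomorphisms along a field extension is injective
(`Hom.baseChange_injective`, [GortzWedhorn2020] Thm. 14.72 (1)) and `e` is an isomorphism.
[cite: GortzWedhorn2020, Theorem 14.72 (1)] -/
theorem endTransport_injective (e : A₁.baseChange Ω ≅ A) : Injective (endTransport e) := by
  intro f g hfg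
  rw [endTransport_apply, endTransport_apply] at hfg
  have h1 : Hom.baseChange Ω f ≫ e.hom = Hom.baseChange Ω g ≫ e.hom := (cancel_epi e.inv).1 hfg
  exact Hom.baseChange_injective Ω ((cancel_mono e.hom).1 h1)

/-! ### §3. Descent of a ring of endomorphisms -/

/-- **Descent of a ring homomorphism `ι : R → End A` along `e : A₁ ⊗_k Ω ≅ A`** ([Shimura1998] §12.4, proof of
Prop. 26: «`ι` is defined over» the field of definition of `A` and of the images of finitely many generators): if
`G ⊆ R` generates `R` as a ring and every `ι g`, `g ∈ G`, is the transport `e⁻¹ ≫ (f₁)_Ω ≫ e` of SOME endomorphism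
`f₁` of `A₁`, then there is a UNIQUE ring homomorphism `ι₁ : R → End A₁` with `(ι₁ a)_Ω ≫ e.hom = e.hom ≫ ι a` for
all `a ∈ R` — the image of the injective ring homomorphism `endTransport e` is a subring containing `ι(G)`, hence
`ι(R)`. [cite: Shimura1998, §12.4 Prop. 26, proof (p0125 L12–p0126 L1)] [cite: MumfordAV1970, §19 (p. 176)] -/
theorem existsUnique_ringHom_end_descent (e : A₁.baseChange Ω ≅ A) {R : Type v} [Ring R] (ι : R →+* End A)
    (G : Set R) (hG : Subring.closure G = ⊤)
    (h : ∀ g ∈ G, ∃ f₁ : End A₁, Hom.baseChange Ω f₁ ≫ e.hom = e.hom ≫ ι g) :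
    ∃! ι₁ : R →+* End A₁, ∀ a : R, Hom.baseChange Ω (ι₁ a) ≫ e.hom = e.hom ≫ ι a := by
  have hmem : ∀ r, ι r ∈ (endTransport e).range :=
    forall_mem_range_of_subring_closure_eq_top (endTransport e) ι hG fun g hg => by
      obtain ⟨f₁, hf₁⟩ := h g hg
      exact ⟨f₁, (endTransport_apply_eq_iff e f₁ (ι g)).2 hf₁⟩
  obtain ⟨ι₁, hι₁⟩ := exists_ringHom_comp_eq_of_forall_mem_range (endTransport e) (endTransport_injective e) ι hmem
  refine ⟨ι₁, fun a => (endTransport_apply_eq_iff e (ι₁ a) (ι a)).1 (by rw [← hι₁]; rfl), fun ι₂ hι₂ => ?_⟩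
  refine ringHom_comp_left_cancel (endTransport e) (endTransport_injective e) ?_
  rw [hι₁]
  exact RingHom.ext fun a => (endTransport_apply_eq_iff e (ι₂ a) (ι a)).2 (hι₂ a)

/-- Existence form of `existsUnique_ringHom_end_descent`. [cite: Shimura1998, §12.4 Prop. 26, proof (p0125 L12–p0126 L1)] -/
theorem exists_ringHom_end_descent (e : A₁.baseChange Ω ≅ A) {R : Type v} [Ring R] (ι : R →+* End A)
    (G : Set R) (hG : Subring.closure G = ⊤)
    (h : ∀ g ∈ G, ∃ f₁ : End A₁, Hom.baseChange Ω f₁ ≫ e.hom = e.hom ≫ ι g) :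
    ∃ ι₁ : R →+* End A₁, ∀ a : R, Hom.baseChange Ω (ι₁ a) ≫ e.hom = e.hom ≫ ι a :=
  (existsUnique_ringHom_end_descent e ι G hG h).exists

/-- **Uniqueness of the descended action**: two ring homomorphisms `ι₁, ι₂ : R → End A₁` with the same transport
`(ι_j a)_Ω ≫ e.hom = e.hom ≫ ι a` agree (injectivity of base change of endomorphisms).
[cite: GortzWedhorn2020, Theorem 14.72 (1)] -/
theorem ringHom_end_descent_unique (e : A₁.baseChange Ω ≅ A) {R : Type v} [Ring R] (ι : R →+* End A)
    {ι₁ ι₂ : R →+* End A₁} (h₁ : ∀ a : R, Hom.baseChange Ω (ι₁ a) ≫ e.hom = e.hom ≫ ι a)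
    (h₂ : ∀ a : R, Hom.baseChange Ω (ι₂ a) ≫ e.hom = e.hom ≫ ι a) : ι₁ = ι₂ :=
  RingHom.ext fun a => endTransport_injective e
    (((endTransport_apply_eq_iff e (ι₁ a) (ι a)).2 (h₁ a)).trans ((endTransport_apply_eq_iff e (ι₂ a) (ι a)).2 (h₂ a)).symm)

/-- **`𝓞_K`-form on a `ℤ`-basis**: for `ι : 𝓞_K → End A` and a `ℤ`-basis `b` of `𝓞_K` (e.g. Mathlib
`RingOfIntegers.basis K`, finitely indexed), if each of the finitely many `ι (b i)` is the transport of an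
endomorphism of `A₁`, then `ι` descends uniquely to `ι₁ : 𝓞_K → End A₁` with `(ι₁ a)_Ω ≫ e.hom = e.hom ≫ ι a`.
[cite: Shimura1998, §12.4 Prop. 26, proof (p0125 L12–p0126 L1)] -/
theorem existsUnique_ringHom_ringOfIntegers_end_descent (e : A₁.baseChange Ω ≅ A) {K : Type v} [Field K]
    (ι : 𝓞 K →+* End A) {ι' : Type w} (b : Module.Basis ι' ℤ (𝓞 K))
    (h : ∀ i : ι', ∃ f₁ : End A₁, Hom.baseChange Ω f₁ ≫ e.hom = e.hom ≫ ι (b i)) :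
    ∃! ι₁ : 𝓞 K →+* End A₁, ∀ a : 𝓞 K, Hom.baseChange Ω (ι₁ a) ≫ e.hom = e.hom ≫ ι a :=
  existsUnique_ringHom_end_descent e ι (Set.range b) (subring_closure_range_basis_eq_top b)
    (by rintro _ ⟨i, rfl⟩; exact h i)

/-- **`𝓞_K`-form, family shape**: if a descent `e : A₁ ⊗_k Ω ≅ A` of `A` CARRIES the finite family
`i ↦ ι (b i)` (`b` a `ℤ`-basis of `𝓞_K`) as a family `r₁ : ι' → End A₁` with `(r₁ i)_Ω ≫ e.hom = e.hom ≫ ι (b i)`,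
then `ι : 𝓞_K → End A` descends to `ι₁ : 𝓞_K → End A₁` with `(ι₁ a)_Ω ≫ e.hom = e.hom ≫ ι a` for all `a`
(and `ι₁ (b i) = r₁ i`).  This is the CM-structure half of [Shimura1998] §12.4 Prop. 26's descent to a smaller
field of definition. [cite: Shimura1998, §12.4 Prop. 26, proof (p0125 L12–p0126 L1)] -/
theorem exists_ringHom_ringOfIntegers_end_descent_of_family (e : A₁.baseChange Ω ≅ A) {K : Type v} [Field K]
    (ι : 𝓞 K →+* End A) {ι' : Type w} (b : Module.Basis ι' ℤ (𝓞 K)) (r₁ : ι' → End A₁)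
    (hr : ∀ i : ι', Hom.baseChange Ω (r₁ i) ≫ e.hom = e.hom ≫ ι (b i)) :
    ∃ ι₁ : 𝓞 K →+* End A₁, (∀ a : 𝓞 K, Hom.baseChange Ω (ι₁ a) ≫ e.hom = e.hom ≫ ι a) ∧ ∀ i : ι', ι₁ (b i) = r₁ i := by
  obtain ⟨ι₁, hι₁, -⟩ := existsUnique_ringHom_ringOfIntegers_end_descent e ι b fun i => ⟨r₁ i, hr i⟩
  refine ⟨ι₁, hι₁, fun i => endTransport_injective e ?_⟩
  exact ((endTransport_apply_eq_iff e _ _).2 (hι₁ (b i))).trans ((endTransport_apply_eq_iff e _ _).2 (hr i)).symm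

/-! ### §4. Two-step descents: composing equivariant comparisons along a tower `k → k′ → S` -/

section Tower

variable {k' : Type u} [Field k'] {S : Type u} [Field S] [Algebra k k'] [Algebra k' S] [Algebra k S]
  [IsScalarTower k k' S]
variable {A₀ : AbelianVariety k} {A₁' : AbelianVariety k'} {A' : AbelianVariety S}

/-- **The comparison `A₀ ⊗_k S ≅ A` of a two-step descent**: from `e₀ : A₀ ⊗_k k′ ≅ A₁` and `e₁ : A₁ ⊗_{k′} S ≅ A`
in a tower `k → k′ → S`, the isomorphism `A₀ ⊗_k S ≅ (A₀ ⊗_k k′) ⊗_{k′} S ≅ A₁ ⊗_{k′} S ≅ A` (transitivity of base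
change, the tree's `baseChangeTowerIso`; then `(e₀)_S`; then `e₁`). [cite: GortzWedhorn2020, Prop. 4.16 and Remark 16.54] -/
def towerComparison (e₀ : A₀.baseChange k' ≅ A₁') (e₁ : A₁'.baseChange S ≅ A') : A₀.baseChange S ≅ A' :=
  (baseChangeTowerIso k k' S A₀).symm ≪≫ (baseChangeFunctor k' S).mapIso e₀ ≪≫ e₁

/-- The underlying homomorphism of `towerComparison e₀ e₁` (definitional). [cite: GortzWedhorn2020, Prop. 4.16] -/
theorem towerComparison_hom (e₀ : A₀.baseChange k' ≅ A₁') (e₁ : A₁'.baseChange S ≅ A') :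
    (towerComparison e₀ e₁).hom = (baseChangeTowerIso k k' S A₀).inv ≫ Hom.baseChange S e₀.hom ≫ e₁.hom := rfl

/-- **Equivariant comparisons compose along a tower**: if `(ι₀ a)_{k′} ≫ e₀.hom = e₀.hom ≫ ι₁ a` and
`(ι₁ a)_S ≫ e₁.hom = e₁.hom ≫ ι a` for all `a`, then `(ι₀ a)_S ≫ e.hom = e.hom ≫ ι a` for `e = towerComparison e₀ e₁`
(naturality of the tower isomorphism, the tree's `baseChangeTowerIso_inv_comp_baseChange_baseChange`, and
functoriality of base change). [cite: GortzWedhorn2020, Prop. 4.16 and Remark 16.54] [cite: MumfordAV1970, §19 (p. 176)] -/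
theorem Hom.baseChange_comp_towerComparison_hom (e₀ : A₀.baseChange k' ≅ A₁') (e₁ : A₁'.baseChange S ≅ A')
    {R : Type v} [Ring R] {ι₀ : R →+* End A₀} {ι₁ : R →+* End A₁'} {ι : R →+* End A'}
    (h₀ : ∀ a : R, Hom.baseChange k' (ι₀ a) ≫ e₀.hom = e₀.hom ≫ ι₁ a)
    (h₁ : ∀ a : R, Hom.baseChange S (ι₁ a) ≫ e₁.hom = e₁.hom ≫ ι a) (a : R) :
    Hom.baseChange S (ι₀ a) ≫ (towerComparison e₀ e₁).hom = (towerComparison e₀ e₁).hom ≫ ι a := by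
  rw [towerComparison_hom, ← Category.assoc (Hom.baseChange S (ι₀ a : A₀ ⟶ A₀)),
    ← baseChangeTowerIso_inv_comp_baseChange_baseChange, Category.assoc, Category.assoc, Category.assoc,
    ← Category.assoc (Hom.baseChange S (Hom.baseChange k' (ι₀ a : A₀ ⟶ A₀))), ← Hom.baseChange_comp, h₀ a,
    Hom.baseChange_comp, Category.assoc, h₁ a]

/-- **Two-step descent of a structure `(A, ι)`** (existence form): descents `(A₁, ι₁) ⊗_{k′} S ≅ (A, ι)` and
`(A₀, ι₀) ⊗_k k′ ≅ (A₁, ι₁)` give a descent `(A₀, ι₀) ⊗_k S ≅ (A, ι)` — e.g. `S = ℂ`, `k′ = ℚ̄`, `k` a number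
field, as in [Shimura1998] §12.4 Prop. 26. [cite: Shimura1998, §12.4 Prop. 26, proof (p0125 L12–p0126 L1)]
[cite: GortzWedhorn2020, Prop. 4.16] -/
theorem exists_iso_forall_baseChange_comp_eq_of_tower (e₀ : A₀.baseChange k' ≅ A₁') (e₁ : A₁'.baseChange S ≅ A')
    {R : Type v} [Ring R] {ι₀ : R →+* End A₀} {ι₁ : R →+* End A₁'} {ι : R →+* End A'}
    (h₀ : ∀ a : R, Hom.baseChange k' (ι₀ a) ≫ e₀.hom = e₀.hom ≫ ι₁ a)
    (h₁ : ∀ a : R, Hom.baseChange S (ι₁ a) ≫ e₁.hom = e₁.hom ≫ ι a) :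
    ∃ e : A₀.baseChange S ≅ A', ∀ a : R, Hom.baseChange S (ι₀ a) ≫ e.hom = e.hom ≫ ι a :=
  ⟨towerComparison e₀ e₁, Hom.baseChange_comp_towerComparison_hom e₀ e₁ h₀ h₁⟩

end Tower

end AbelianVariety

end Literature.AlgebraicGeometry.Motives

end
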